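import Summits.Ventures.CertifiedQuantumChemistry.Rows.OverlapObservableRows
import Literature.MathematicalPhysics.QuantumChemistry.LocalSpinOperators
import HarnessLib

/-!
# Ventures/CertifiedQuantumChemistry — Rows/LocalSpinRows.lean: CERTIFIED LOCAL MOMENTS AND INTER-GROUP
# SPIN CORRELATIONS ⟨Ŝ_A·Ŝ_B⟩ OF EVERY SINGLET GROUND STATE, read behind a ground-state-weight row

HONEST FRAMING (verbatim, page 1 of every file of the cell): certified bounds for a stated model
Hamiltonian in a stated basis; not a claim about the real molecule or material beyond that model.
The orbital groups `A`, `B` are FCIDUMP INDEX SETS of the pinned model; «A = the Fe₁-type orbitals» is a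
VALIDATED-side / deposit-derived attribution and never part of a certified sentence.
WHAT THIS IS NOT: no number, no certificate, no claim node; a typed statement certifies nothing by itself.
Typer chem-type-06 (cell chem-oracle, I-TYPE slot 06, GS-obs door (M); zero compute; nothing landed is touched).

WHY. `Rows/OverlapObservableRows` reads any bounded observable `O` of EVERY singlet ground state from a
weight row `SingletOverlapLowerRow F n φ w` plus ONE certified first-moment enclosure of `O` at `φ` and a
form datum `|⟨x,(O − m)x⟩| ≤ h‖x‖²`. `Literature/…/LocalSpinOperators` supplies the form data of the
DIAGONAL correlators `Ŝᶻ_A Ŝᶻ_B` (`m = 0`, `h ≥ |A||B|/4`) and `(Ŝᶻ_A)²` (`m = h ≥ |A|²/8`) and the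
SINGLET ISOTROPY `⟨ψ, Ŝ_A·Ŝ_B ψ⟩ = 3⟨ψ, Ŝᶻ_AŜᶻ_B ψ⟩` (`expect_localSpinDot_of_isInSector`). Composed:
* `Model.IsSingletGroundState.re_localSpinDot_eq` — for every singlet ground state the full spin–spin
  correlation is three times the `z–z` one;
* `SingletOverlapLowerRow.forall_re_localSpinZ_mul_mem_of_slots` — the `z–z` cell
  `lo⟨ψ,ψ⟩ ≤ Re⟨ψ, Ŝᶻ_AŜᶻ_B ψ⟩ ≤ hi⟨ψ,ψ⟩` for EVERY singlet ground state (the generic reader instantiated);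
* `SingletOverlapLowerRow.forall_re_localSpinDot_mem_of_slots` — hence
  `3lo⟨ψ,ψ⟩ ≤ Re⟨ψ, Ŝ_A·Ŝ_B ψ⟩ ≤ 3hi⟨ψ,ψ⟩`: the printed object of iron–sulfur analyses («spin-spin
  correlation functions ⟨S⃗_Feᵢ·S⃗_Feⱼ⟩ … anti-ferromagnetically coupled to form a global singlet state»,
  Li–Chan 2017 §3.2 p. 29) CERTIFIED FOR THE MODEL, sign included;
* `SingletOverlapLowerRow.forall_re_localSpinSq_mem_of_slots` — the local moment `⟨Ŝ²_A⟩_ψ ∈ 3·[lo, hi]`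
  from the `(Ŝᶻ_A)²` cell.
Inputs of a row: the weight row (e.g. CERTIFIED-CHEM #51), the record's norm enclosure `Nlo ≤ ⟨φ,φ⟩ ≤ Nhi`
and first-moment enclosure of the DIAGONAL correlator at `φ` (a certnum `⟨φ, n̂_pσ n̂_qτ φ⟩` record), and
the eleven rational slots of `re_form_mem_of_weight_slots`; `h` is any rational with `|A||B| ≤ 4h`
(resp. `|A|² ≤ 8h`), discharged by `norm_num` from `A.card`, `B.card`.
-/

noncomputable section

namespace Summit.Ventures.CertifiedQuantumChemistry

open Matrix Finset
open Literature.MathematicalPhysics.QuantumLattice Literature.MathematicalPhysics.QuantumChemistry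
open scoped ComplexOrder

variable {k : ℕ} {F : Model k}

/-- **Every singlet ground state is isotropic**: `Re⟨ψ, Ŝ_A·Ŝ_B ψ⟩ = 3·Re⟨ψ, Ŝᶻ_AŜᶻ_B ψ⟩` for
`ψ ∈ K = singletSector k n` (sector `(n,n)` and `Ŝ₊ψ = 0`), any index sets `A, B`.
[cite: BraunscheidelBachharMayhall2024, §2.2.2 eq. (13)] -/
theorem Model.IsSingletGroundState.re_localSpinDot_eq {n : ℕ} {ψ : Fock (Orb (Fin k))}
    (hψ : F.IsSingletGroundState n ψ) (A B : Finset (Fin k)) :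
    (star ψ ⬝ᵥ localSpinDot A B *ᵥ ψ).re =
      3 * (star ψ ⬝ᵥ (localSpinZ A * localSpinZ B) *ᵥ ψ).re := by
  obtain ⟨hK, -, -⟩ := hψ
  rw [mem_singletSector_iff_isInSector] at hK
  rw [expect_localSpinDot_of_isInSector hK.1 hK.2, show (3 : ℂ) = ((3 : ℝ) : ℂ) by norm_num,
    Complex.re_ofReal_mul]

/-- **The `z–z` correlator cell of EVERY singlet ground state** behind a weight row: the generic reader
`SingletOverlapLowerRow.forall_re_form_mem_of_slots` instantiated with `O = Ŝᶻ_AŜᶻ_B` and its form datum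
(`m = 0`, `|A||B| ≤ 4h`). [cite: Goodisman1973, Ch. III §A.2 eqs. (27)–(28), p. 97] -/
theorem SingletOverlapLowerRow.forall_re_localSpinZ_mul_mem_of_slots (hF : F.IsSymmetric) {n : ℕ}
    {φ : Fock (Orb (Fin k))} {w : ℚ} (hrow : SingletOverlapLowerRow F n φ w) (A B : Finset (Fin k))
    {h : ℚ} (hh : (A.card : ℚ) * (B.card : ℚ) ≤ 4 * h) {Nlo Nhi ρ Alo Ahi l u t lo hi : ℚ}
    (hNlo : 0 < Nlo) (hφlo : ((Nlo : ℚ) : ℝ) ≤ (star φ ⬝ᵥ φ).re)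
    (hφhi : (star φ ⬝ᵥ φ).re ≤ ((Nhi : ℚ) : ℝ))
    (hAlo : ((Alo : ℚ) : ℝ) ≤
      (star φ ⬝ᵥ (localSpinZ A * localSpinZ B) *ᵥ φ).re - ((ρ : ℚ) : ℝ) * (star φ ⬝ᵥ φ).re)
    (hAhi : (star φ ⬝ᵥ (localSpinZ A * localSpinZ B) *ᵥ φ).re - ((ρ : ℚ) : ℝ) * (star φ ⬝ᵥ φ).re
      ≤ ((Ahi : ℚ) : ℝ))
    (hl : l * Nlo ≤ Alo ∧ l * Nhi ≤ Alo) (hu : Ahi ≤ u * Nlo ∧ Ahi ≤ u * Nhi)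
    (ht : 0 ≤ t ∧ 4 * h ^ 2 * (1 - w) ≤ t ^ 2)
    (hlo : lo ≤ ρ + l - t - 2 * h * (1 - w)) (hhi : ρ + u + t + 2 * h * (1 - w) ≤ hi) :
    ∀ ψ : Fock (Orb (Fin k)), F.IsSingletGroundState n ψ →
      ((lo : ℚ) : ℝ) * (star ψ ⬝ᵥ ψ).re ≤ (star ψ ⬝ᵥ (localSpinZ A * localSpinZ B) *ᵥ ψ).re ∧
        (star ψ ⬝ᵥ (localSpinZ A * localSpinZ B) *ᵥ ψ).re ≤ ((hi : ℚ) : ℝ) * (star ψ ⬝ᵥ ψ).re :=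
  hrow.forall_re_form_mem_of_slots hF (localSpinZ_mul_localSpinZ_form_bound A B hh) hNlo hφlo hφhi
    hAlo hAhi hl hu ht hlo hhi

/-- **CERTIFIED SPIN–SPIN CORRELATION OF EVERY SINGLET GROUND STATE**: with the inputs of the `z–z`
cell, `3·lo·⟨ψ,ψ⟩ ≤ Re⟨ψ, Ŝ_A·Ŝ_B ψ⟩ ≤ 3·hi·⟨ψ,ψ⟩` for every singlet ground state `ψ` (isotropy × the
cell). With `hi < 0` this certifies ANTIFERROMAGNETIC correlation of the groups `A`, `B` in the model's
singlet ground state(s). [cite: BraunscheidelBachharMayhall2024, §2.2.2 eq. (13)] -/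
theorem SingletOverlapLowerRow.forall_re_localSpinDot_mem_of_slots (hF : F.IsSymmetric) {n : ℕ}
    {φ : Fock (Orb (Fin k))} {w : ℚ} (hrow : SingletOverlapLowerRow F n φ w) (A B : Finset (Fin k))
    {h : ℚ} (hh : (A.card : ℚ) * (B.card : ℚ) ≤ 4 * h) {Nlo Nhi ρ Alo Ahi l u t lo hi : ℚ}
    (hNlo : 0 < Nlo) (hφlo : ((Nlo : ℚ) : ℝ) ≤ (star φ ⬝ᵥ φ).re)
    (hφhi : (star φ ⬝ᵥ φ).re ≤ ((Nhi : ℚ) : ℝ))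
    (hAlo : ((Alo : ℚ) : ℝ) ≤
      (star φ ⬝ᵥ (localSpinZ A * localSpinZ B) *ᵥ φ).re - ((ρ : ℚ) : ℝ) * (star φ ⬝ᵥ φ).re)
    (hAhi : (star φ ⬝ᵥ (localSpinZ A * localSpinZ B) *ᵥ φ).re - ((ρ : ℚ) : ℝ) * (star φ ⬝ᵥ φ).re
      ≤ ((Ahi : ℚ) : ℝ))
    (hl : l * Nlo ≤ Alo ∧ l * Nhi ≤ Alo) (hu : Ahi ≤ u * Nlo ∧ Ahi ≤ u * Nhi)
    (ht : 0 ≤ t ∧ 4 * h ^ 2 * (1 - w) ≤ t ^ 2)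
    (hlo : lo ≤ ρ + l - t - 2 * h * (1 - w)) (hhi : ρ + u + t + 2 * h * (1 - w) ≤ hi) :
    ∀ ψ : Fock (Orb (Fin k)), F.IsSingletGroundState n ψ →
      3 * ((lo : ℚ) : ℝ) * (star ψ ⬝ᵥ ψ).re ≤ (star ψ ⬝ᵥ localSpinDot A B *ᵥ ψ).re ∧
        (star ψ ⬝ᵥ localSpinDot A B *ᵥ ψ).re ≤ 3 * ((hi : ℚ) : ℝ) * (star ψ ⬝ᵥ ψ).re := by
  intro ψ hψ
  have hz := hrow.forall_re_localSpinZ_mul_mem_of_slots hF A B hh hNlo hφlo hφhi hAlo hAhi hl hu ht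
    hlo hhi ψ hψ
  rw [hψ.re_localSpinDot_eq]
  constructor <;> linarith [hz.1, hz.2]

/-- **CERTIFIED LOCAL MOMENT OF EVERY SINGLET GROUND STATE**: from the `(Ŝᶻ_A)²` cell (form datum
`m = h`, `|A|² ≤ 8h`), `3·lo·⟨ψ,ψ⟩ ≤ Re⟨ψ, Ŝ²_A ψ⟩ ≤ 3·hi·⟨ψ,ψ⟩` for every singlet ground state `ψ`
(`Ŝ²_A = Ŝ_A·Ŝ_A`; «local spin `Ŝ²_I`»). [cite: BraunscheidelBachharMayhall2024, §2.2.2 eq. (13)] -/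
theorem SingletOverlapLowerRow.forall_re_localSpinSq_mem_of_slots (hF : F.IsSymmetric) {n : ℕ}
    {φ : Fock (Orb (Fin k))} {w : ℚ} (hrow : SingletOverlapLowerRow F n φ w) (A : Finset (Fin k))
    {h : ℚ} (hh : (A.card : ℚ) ^ 2 ≤ 8 * h) {Nlo Nhi ρ Alo Ahi l u t lo hi : ℚ}
    (hNlo : 0 < Nlo) (hφlo : ((Nlo : ℚ) : ℝ) ≤ (star φ ⬝ᵥ φ).re)
    (hφhi : (star φ ⬝ᵥ φ).re ≤ ((Nhi : ℚ) : ℝ))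
    (hAlo : ((Alo : ℚ) : ℝ) ≤
      (star φ ⬝ᵥ (localSpinZ A * localSpinZ A) *ᵥ φ).re - ((ρ : ℚ) : ℝ) * (star φ ⬝ᵥ φ).re)
    (hAhi : (star φ ⬝ᵥ (localSpinZ A * localSpinZ A) *ᵥ φ).re - ((ρ : ℚ) : ℝ) * (star φ ⬝ᵥ φ).re
      ≤ ((Ahi : ℚ) : ℝ))
    (hl : l * Nlo ≤ Alo ∧ l * Nhi ≤ Alo) (hu : Ahi ≤ u * Nlo ∧ Ahi ≤ u * Nhi)
    (ht : 0 ≤ t ∧ 4 * h ^ 2 * (1 - w) ≤ t ^ 2)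
    (hlo : lo ≤ ρ + l - t - 2 * h * (1 - w)) (hhi : ρ + u + t + 2 * h * (1 - w) ≤ hi) :
    ∀ ψ : Fock (Orb (Fin k)), F.IsSingletGroundState n ψ →
      3 * ((lo : ℚ) : ℝ) * (star ψ ⬝ᵥ ψ).re ≤ (star ψ ⬝ᵥ localSpinDot A A *ᵥ ψ).re ∧
        (star ψ ⬝ᵥ localSpinDot A A *ᵥ ψ).re ≤ 3 * ((hi : ℚ) : ℝ) * (star ψ ⬝ᵥ ψ).re := by
  intro ψ hψ
  have hz := hrow.forall_re_form_mem_of_slots hF (localSpinZ_sq_form_bound A hh) hNlo hφlo hφhi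
    hAlo hAhi hl hu ht hlo hhi ψ hψ
  rw [hψ.re_localSpinDot_eq]
  constructor <;> linarith [hz.1, hz.2]

end Summit.Ventures.CertifiedQuantumChemistry

end
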